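import Literature.NumberTheory.LFunctions.BurnolFourierZetaSonine
import Literature.Analysis.FunctionSpaces.L2ProductHilbertBasis
import HarnessLib

/-!
# Burnol 2004, Prop. 6.6 (iii): the Sonine functions `⋃_{λ>0} K_λ` are dense in `K = L²((0,∞),dt)` —
# DISCHARGE of `Burnol2004_prop_6_6`

LINE 1 — LABEL: RH-FREE (a density theorem about even `L²` functions and the `L²` Fourier transform;
the Riemann zeta function does not occur). FRAMING (cell rh-crit, D-0074): corpus theorems are RH-FREE
literature; nothing here is worded as progress toward RH. bears_on: B-C/B-P (LADDER-RH COLUMN 6, de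
Branges framework). WHAT THIS IS NOT: not a route, not a criterion; discharging a structural statement
about the Sonine chain `K_λ` fixes the vocabulary of a corpus, it does not move RH. Nothing here bears on
the truth of RH.

Source: J.-F. Burnol, *On Fourier and Zeta(s)*, Forum Math. **16** (2004) 789–840 = arXiv:math/0112254
[Burnol2004], Prop. 6.6 (TeX of record `rh-crit/dbl/src/Burnol2004ForumMath_arXivmath0112254.tex`
l.2351–2368): "Furthermore `L²((0,∞),dt) = closure ⋃_{λ>0} K_λ`", typed in `BurnolFourierZetaSonine.lean`
as the named fact `Burnol2004_prop_6_6 : closure (⋃ lam ∈ Ioi 0, sonineK lam) = evenL2` (Burnol's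
`K = L²((0,∞),dt)` ↦ the a.e.-even classes `evenL2` of `L²(ℝ)`, `K_λ` ↦ `sonineK λ`, `𝓕₊` ↦ Mathlib's
`L²` Fourier transform `𝓕`, as everywhere in the tree's Burnol files).

## What is PROVED (theorem-only module: no definition, no named fact)

* `Burnol2004_prop_6_6_holds : Burnol2004_prop_6_6`.

DEVIATION FROM THE PRINTED PROOF (declared, not hidden). Burnol proves clause (ii) `K_λ = closure ⋃_{μ>λ}
K_μ` through de Branges' theory (a vector `φ ⊥ K_μ` has components in `H²(λ Re s > 1/2)` whose quotient by
the entire functions `g^μ` is independent of `μ` …, TeX l.2360–2367) and then says "The same proof shows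
the last statement" (TeX l.2368). For clause (iii) ALONE an elementary Hilbert-space argument suffices,
and it is the one formalised here; it runs through the operator `P_λ𝓕₊P_λ` which Burnol himself invokes
in the same section ("the fact that `⋃_{λ>0} K_λ` is dense in `L²(0,∞;dt)` is proven directly", TeX
l.2258–2259, and the bound `‖P_λ𝓕₊P_λ‖ < 1` from [Dym–McKean], TeX l.2283–2290):

1. (Hilbert–Schmidt / Cauchy–Schwarz bound.) If `b ∈ L²(ℝ)` has `𝓕b` supported in `s = (−r,r)` then
   `b = 𝓕(R𝓕b)` is the Fourier integral of an `L¹ ∩ L²` function of `L¹`-norm `≤ √|s|·‖b‖`, so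
   `|b| ≤ √|s|·‖b‖` a.e.; hence for `a` supported in `s`, `|⟨a,b⟩| ≤ |s|·‖a‖‖b‖` (`= 2r‖a‖‖b‖`).
2. (Orthogonality transfer.) Let `t` be even and orthogonal to `K_r`. If `v ∈ L²(ℝ)` vanishes a.e. on `s`
   together with `𝓕v`, then `v + Rv ∈ K_r` (`R u = u(−·)`; `𝓕R = R𝓕`) and `⟨Rv, t⟩ = ⟨v, t⟩`, so
   `⟨v, t⟩ = 0`. With `A = {a : a = 0 off s}`, `B = {b : 𝓕b = 0 off s}` (closed subspaces, `(A ⊔ B)ᗮ =`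
   the `v` above) this says `t ∈ (A ⊔ B)ᗮᗮ = closure (A + B)`.
3. (Quasi-orthogonal decomposition.) For `w = a + b ∈ A + B` with `2r ≤ 1/2`, step 1 gives
   `‖a‖² + ‖b‖² ≤ 2‖w‖²`, and `|⟨a,t⟩| ≤ ‖a‖·‖𝟙_s t‖`, `|⟨b,t⟩| = |⟨𝓕b,𝓕t⟩| ≤ ‖b‖·‖𝟙_s 𝓕t‖`; letting
   `w → t` yields `‖t‖² ≤ 2‖t‖(‖𝟙_{(−r,r)} t‖ + ‖𝟙_{(−r,r)} 𝓕t‖)`, whose right-hand side tends to `0` as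
   `r → 0` (absolute continuity of `∫|t|²`, `∫|𝓕t|²`). So `t = 0`.
4. The union `⋃_{λ>0} K_λ` is directed (the `K_λ` decrease), hence a linear subspace; for `g ∈ K` the
   difference `t = g − P g` with its orthogonal projection `P g` onto the closure is even and orthogonal to
   every `K_λ`, so `t = 0` and `g` lies in the closure.

Tools: Mathlib's `L²` Fourier transform (`MeasureTheory.Lp.fourierTransformₗᵢ`, `Lp.inner_fourier_eq`),
`Submodule.orthogonal_orthogonal_eq_closure`, `MemLp.eLpNorm_indicator_le`; the tree's
`Literature.Analysis.FunctionSpaces.fourier_toLp_ae_eq_fourierIntegral` (`L¹ ∩ L²` consistency),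
`Literature.Analysis.Fourier.fourier_compNeg` / `fourierInv_eq_compNeg_fourier` / `inner_fourier_right`,
and the `K_λ` bookkeeping of `BurnolFourierZetaSonine.lean` / `BurnolSonineFourier.lean`.

Downstream (same namespace): `BurnolHLambdaDensityProofs.lean` (Burnol 2001 CRAS Prop. 2.1 via this
density) and `BurnolSonineChainDensityProofs.lean` (JTNB Prop. 4.5/4.6). (Comment-only re-land of
p440279 to re-enqueue the farm build of this module; no declaration changed.)

## References
* [Burnol2004] J.-F. Burnol, *On Fourier and Zeta(s)*, Forum Math. 16 (2004) 789–840, Prop. 6.6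
  (TeX l.2351–2368), §6 discussion of `P_λ𝓕₊P_λ` (TeX l.2258–2259, 2283–2290).
* [DymMcKean1972] H. Dym, H. P. McKean, *Fourier series and integrals*, Academic Press 1972, §2.9
  (the operator `P_λ𝓕P_λ`; cited by Burnol as [10]).
-/

noncomputable section

open MeasureTheory FourierTransform Set Filter
open scoped InnerProductSpace ENNReal Topology ComplexConjugate
open Literature.Analysis.Fourier Literature.Analysis.FunctionSpaces

namespace Literature.NumberTheory.LFunctions

section SonineDensity

/-! ### Step 2: orthogonality transfer (`(A ⊔ B)ᗮ` vectors have their even part in `K_r`) -/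

/-- If `v ∈ L²(ℝ)` is orthogonal to every class vanishing a.e. off `s`, then `v = 0` a.e. on `s` (test
against `𝟙_s v`, whose pairing with `v` is `∫_s |v|²`). [folklore] -/
private theorem ae_eq_zero_of_orthogonal_supported {s : Set ℝ} (hs : MeasurableSet s)
    (v : Lp ℂ 2 (volume : Measure ℝ))
    (hv : ∀ a : Lp ℂ 2 (volume : Measure ℝ), (∀ᵐ x : ℝ, x ∉ s → a x = 0) → ⟪a, v⟫_ℂ = 0) :
    ∀ᵐ x : ℝ, x ∈ s → v x = 0 := by
  set a : Lp ℂ 2 (volume : Measure ℝ) := ((Lp.memLp v).indicator hs).toLp (s.indicator ⇑v) with ha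
  have hae : ⇑a =ᵐ[volume] s.indicator ⇑v := MemLp.coeFn_toLp _
  have hsupp : ∀ᵐ x : ℝ, x ∉ s → a x = 0 := by
    filter_upwards [hae] with x hx hxs
    rw [hx, Set.indicator_of_notMem hxs]
  have h0 := hv a hsupp
  have h1 : ⟪a, v⟫_ℂ = ((∫ x, s.indicator (fun x ↦ ‖v x‖ ^ 2) x : ℝ) : ℂ) := by
    rw [L2.inner_def, ← integral_complex_ofReal]
    refine integral_congr_ae ?_
    filter_upwards [hae] with x hx
    rw [RCLike.inner_apply, hx]
    by_cases hxs : x ∈ s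
    · rw [Set.indicator_of_mem hxs, Set.indicator_of_mem hxs, Complex.mul_conj,
        Complex.normSq_eq_norm_sq]
    · simp [Set.indicator_of_notMem hxs]
  have hint : Integrable (s.indicator fun x ↦ ‖v x‖ ^ 2) := (integrable_sq_norm_Lp v).indicator hs
  have h2 : ∫ x, s.indicator (fun x ↦ ‖v x‖ ^ 2) x = 0 := by
    have := h0.symm.trans h1
    exact_mod_cast this.symm
  have h3 := (integral_eq_zero_iff_of_nonneg (fun x ↦ ?_) hint).1 h2
  · filter_upwards [h3] with x hx hxs
    have : ‖v x‖ ^ 2 = 0 := by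
      have hx' : s.indicator (fun x ↦ ‖v x‖ ^ 2) x = 0 := hx
      rwa [Set.indicator_of_mem hxs] at hx'
    exact norm_eq_zero.1 (pow_eq_zero_iff two_ne_zero |>.1 this)
  · by_cases hxs : x ∈ s
    · simp only [Set.indicator_of_mem hxs, Pi.zero_apply]; positivity
    · simp [Set.indicator_of_notMem hxs]

/-- If `v` is orthogonal to every `b` whose Fourier transform vanishes a.e. off `s`, then `𝓕v` is
orthogonal to every `a` vanishing a.e. off `s` (`⟨a, 𝓕v⟩ = ⟨𝓕⁻a, v⟩`, `𝓕𝓕⁻a = a`). [folklore] -/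
private theorem fourier_orthogonal_supported {s : Set ℝ} (v : Lp ℂ 2 (volume : Measure ℝ))
    (hv : ∀ b : Lp ℂ 2 (volume : Measure ℝ),
      (∀ᵐ x : ℝ, x ∉ s → ((𝓕 b : Lp ℂ 2 (volume : Measure ℝ)) : ℝ → ℂ) x = 0) → ⟪b, v⟫_ℂ = 0) :
    ∀ a : Lp ℂ 2 (volume : Measure ℝ), (∀ᵐ x : ℝ, x ∉ s → a x = 0) →
      ⟪a, (𝓕 v : Lp ℂ 2 (volume : Measure ℝ))⟫_ℂ = 0 := by
  intro a ha
  rw [inner_fourier_right]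
  apply hv
  rw [fourier_fourierInv_eq]
  exact ha

/-- For an even `t`, the pairing with the reflection `Rv = v(−·)` equals the pairing with `v`.
[folklore] -/
private theorem inner_compNeg_left_of_mem_evenL2 (v : Lp ℂ 2 (volume : Measure ℝ))
    {t : Lp ℂ 2 (volume : Measure ℝ)} (ht : t ∈ evenL2) :
    ⟪Lp.compMeasurePreserving (fun x : ℝ ↦ -x) (Measure.measurePreserving_neg (volume : Measure ℝ)) v,
      t⟫_ℂ = ⟪v, t⟫_ℂ := by
  have ht' : ∀ᵐ x : ℝ, t (-x) = t x := ht
  rw [L2.inner_def, L2.inner_def]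
  have h1 := coeFn_compNeg (F := ℂ) v
  calc ∫ x, ⟪(Lp.compMeasurePreserving (fun x : ℝ ↦ -x)
          (Measure.measurePreserving_neg (volume : Measure ℝ)) v : ℝ → ℂ) x, t x⟫_ℂ
      = ∫ x, ⟪v (-x), t (-x)⟫_ℂ := by
        refine integral_congr_ae ?_
        filter_upwards [h1, ht'] with x hx htx
        rw [hx, htx]
    _ = ∫ x, ⟪v x, t x⟫_ℂ :=
        (Measure.measurePreserving_neg (volume : Measure ℝ)).integral_comp
          (Homeomorph.neg ℝ).measurableEmbedding (fun x ↦ ⟪v x, t x⟫_ℂ)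

/-- If `v` and `𝓕v` vanish a.e. on `(−r, r)` then `v + Rv ∈ K_r` (`R` the reflection; `𝓕R = R𝓕`).
[cite: Burnol2004, Definition 6.1 (TeX l.2224–2228)] -/
private theorem add_compNeg_mem_sonineK {r : ℝ} (v : Lp ℂ 2 (volume : Measure ℝ))
    (h1 : ∀ᵐ x : ℝ, x ∈ Ioo (-r) r → v x = 0)
    (h2 : ∀ᵐ x : ℝ, x ∈ Ioo (-r) r → ((𝓕 v : Lp ℂ 2 (volume : Measure ℝ)) : ℝ → ℂ) x = 0) :
    v + Lp.compMeasurePreserving (fun x : ℝ ↦ -x) (Measure.measurePreserving_neg (volume : Measure ℝ)) v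
      ∈ sonineK r := by
  have hneg : Measure.QuasiMeasurePreserving (fun x : ℝ ↦ -x) volume volume :=
    (Measure.measurePreserving_neg (volume : Measure ℝ)).quasiMeasurePreserving
  have hR := coeFn_compNeg (F := ℂ) v
  have hadd := Lp.coeFn_add v (Lp.compMeasurePreserving (fun x : ℝ ↦ -x)
    (Measure.measurePreserving_neg (volume : Measure ℝ)) v)
  refine ⟨?_, ?_, ?_⟩
  · have hadd' := hneg.ae hadd
    have hR' := hneg.ae hR
    simp only [evenL2, Set.mem_setOf_eq]
    filter_upwards [hadd, hadd', hR, hR'] with x ha ha' hb hb'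
    rw [ha', ha, Pi.add_apply, Pi.add_apply, hb, hb', neg_neg, add_comm]
  · have h1' := hneg.ae h1
    filter_upwards [hadd, hR, h1, h1'] with x ha hb hz hz' hx
    rw [ha, Pi.add_apply, hb, hz ⟨by linarith [hx.1, hx.2], hx.2⟩,
      hz' ⟨by linarith [hx.1, hx.2], by linarith [hx.1, hx.2]⟩, add_zero]
  · have hF : (𝓕 (v + Lp.compMeasurePreserving (fun x : ℝ ↦ -x)
        (Measure.measurePreserving_neg (volume : Measure ℝ)) v) : Lp ℂ 2 (volume : Measure ℝ)) =
        (𝓕 v : Lp ℂ 2 (volume : Measure ℝ)) + Lp.compMeasurePreserving (fun x : ℝ ↦ -x)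
          (Measure.measurePreserving_neg (volume : Measure ℝ)) (𝓕 v : Lp ℂ 2 (volume : Measure ℝ)) := by
      rw [FourierAdd.fourier_add, fourier_compNeg]
    rw [hF]
    have hadd2 := Lp.coeFn_add (𝓕 v : Lp ℂ 2 (volume : Measure ℝ))
      (Lp.compMeasurePreserving (fun x : ℝ ↦ -x) (Measure.measurePreserving_neg (volume : Measure ℝ))
        (𝓕 v : Lp ℂ 2 (volume : Measure ℝ)))
    have hR2 := coeFn_compNeg (F := ℂ) (𝓕 v : Lp ℂ 2 (volume : Measure ℝ))
    have h2' := hneg.ae h2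
    filter_upwards [hadd2, hR2, h2, h2'] with x ha hb hz hz' hx
    rw [ha, Pi.add_apply, hb, hz ⟨by linarith [hx.1, hx.2], hx.2⟩,
      hz' ⟨by linarith [hx.1, hx.2], by linarith [hx.1, hx.2]⟩, add_zero]

/-- **Orthogonality transfer.** If `t` is even and orthogonal to `K_r`, and `v`, `𝓕v` vanish a.e. on
`(−r,r)`, then `⟨v, t⟩ = 0` (as `⟨v + Rv, t⟩ = 2⟨v, t⟩` and `v + Rv ∈ K_r`).
[cite: Burnol2004, Definition 6.1 and Prop. 6.6 (TeX l.2224–2228, 2351–2368)] -/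
private theorem inner_eq_zero_of_vanishing {r : ℝ} {t : Lp ℂ 2 (volume : Measure ℝ)}
    (ht : t ∈ evenL2) (hK : ∀ k ∈ sonineK r, ⟪k, t⟫_ℂ = 0) (v : Lp ℂ 2 (volume : Measure ℝ))
    (h1 : ∀ᵐ x : ℝ, x ∈ Ioo (-r) r → v x = 0)
    (h2 : ∀ᵐ x : ℝ, x ∈ Ioo (-r) r → ((𝓕 v : Lp ℂ 2 (volume : Measure ℝ)) : ℝ → ℂ) x = 0) :
    ⟪v, t⟫_ℂ = 0 := by
  have h := hK _ (add_compNeg_mem_sonineK v h1 h2)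
  rw [inner_add_left, inner_compNeg_left_of_mem_evenL2 v ht, ← two_mul] at h
  exact (mul_eq_zero.1 h).resolve_left two_ne_zero

/-! ### Step 1: the Cauchy–Schwarz / Hilbert–Schmidt bounds -/

/-- An `L²` class vanishing a.e. off a set of finite measure is integrable, with
`∫|c| ≤ √|s|·‖c‖₂` (Cauchy–Schwarz). [folklore] -/
private theorem integral_norm_le_of_supported {s : Set ℝ} (hs : MeasurableSet s)
    (hμs : volume s ≠ ∞) (c : Lp ℂ 2 (volume : Measure ℝ)) (hc : ∀ᵐ x : ℝ, x ∉ s → c x = 0) :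
    Integrable (fun x ↦ (c : ℝ → ℂ) x) ∧ ∫ x, ‖c x‖ ≤ Real.sqrt (volume.real s) * ‖c‖ := by
  have hind : (fun x ↦ (c : ℝ → ℂ) x) =ᵐ[volume] s.indicator ⇑c := by
    filter_upwards [hc] with x hx
    by_cases hxs : x ∈ s
    · rw [Set.indicator_of_mem hxs]
    · rw [Set.indicator_of_notMem hxs, hx hxs]
  have hfin : IsFiniteMeasure (volume.restrict s) :=
    ⟨by rw [Measure.restrict_apply_univ]; exact lt_top_iff_ne_top.2 hμs⟩
  have hint : Integrable (fun x ↦ (c : ℝ → ℂ) x) := by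
    refine Integrable.congr ?_ hind.symm
    rw [integrable_indicator_iff hs]
    exact ((Lp.memLp c).restrict s).integrable one_le_two
  refine ⟨hint, ?_⟩
  -- `∫|c| = ∫ 𝟙_s |c| ≤ (∫ 𝟙_s²)^{1/2} (∫ |c|²)^{1/2}`
  have hnorm_eq : ∫ x, ‖c x‖ = ∫ x, s.indicator (fun _ ↦ (1 : ℝ)) x * ‖c x‖ := by
    refine integral_congr_ae ?_
    filter_upwards [hc] with x hx
    by_cases hxs : x ∈ s
    · rw [Set.indicator_of_mem hxs, one_mul]
    · rw [Set.indicator_of_notMem hxs, hx hxs, norm_zero, zero_mul]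
  have hone : MemLp (s.indicator fun _ ↦ (1 : ℝ)) (ENNReal.ofReal 2) volume := by
    rw [ENNReal.ofReal_ofNat]
    exact memLp_indicator_const 2 hs 1 (Or.inr hμs)
  have htwo : MemLp (fun x ↦ ‖c x‖) (ENNReal.ofReal 2) volume := by
    rw [ENNReal.ofReal_ofNat]
    exact (Lp.memLp c).norm
  have hH := integral_mul_le_Lp_mul_Lq_of_nonneg Real.HolderConjugate.two_two
    (Eventually.of_forall fun x ↦ Set.indicator_nonneg (fun _ _ ↦ zero_le_one) x)
    (Eventually.of_forall fun x ↦ norm_nonneg (c x)) hone htwo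
  have hsq1 : ∫ x, s.indicator (fun _ ↦ (1 : ℝ)) x ^ (2 : ℝ) = volume.real s := by
    rw [← integral_indicator_one hs]
    refine integral_congr_ae (Eventually.of_forall fun x ↦ ?_)
    by_cases hxs : x ∈ s
    · simp [Set.indicator_of_mem hxs]
    · simp [Set.indicator_of_notMem hxs]
  have hsq2 : ∫ x, ‖c x‖ ^ (2 : ℝ) = ‖c‖ ^ 2 := by
    rw [norm_sq_eq_integral_Lp_two c]
    refine integral_congr_ae (Eventually.of_forall fun x ↦ ?_)
    exact Real.rpow_two _
  rw [hnorm_eq]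
  calc ∫ x, s.indicator (fun _ ↦ (1 : ℝ)) x * ‖c x‖
      ≤ (∫ x, s.indicator (fun _ ↦ (1 : ℝ)) x ^ (2 : ℝ)) ^ (1 / (2 : ℝ)) *
          (∫ x, ‖c x‖ ^ (2 : ℝ)) ^ (1 / (2 : ℝ)) := hH
    _ = Real.sqrt (volume.real s) * ‖c‖ := by
        rw [hsq1, hsq2, ← Real.sqrt_eq_rpow, ← Real.sqrt_eq_rpow, Real.sqrt_sq (norm_nonneg _)]

/-- **Sup-norm bound.** If `𝓕b` vanishes a.e. off `(−r,r)` then `|b| ≤ √(2r)‖b‖` a.e.: `b = 𝓕(R𝓕b)` is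
the Fourier integral of an `L¹ ∩ L²` function of `L¹` norm `≤ √(2r)‖b‖`.
[cite: Burnol2004, §6 (TeX l.2283–2290: the operator `P_λ𝓕₊P_λ`)] -/
private theorem ae_norm_le_of_fourier_supported {r : ℝ} (b : Lp ℂ 2 (volume : Measure ℝ))
    (hb : ∀ᵐ x : ℝ, x ∉ Ioo (-r) r → ((𝓕 b : Lp ℂ 2 (volume : Measure ℝ)) : ℝ → ℂ) x = 0) :
    ∀ᵐ x : ℝ, ‖b x‖ ≤ Real.sqrt (volume.real (Ioo (-r) r)) * ‖b‖ := by
  have hneg : Measure.QuasiMeasurePreserving (fun x : ℝ ↦ -x) volume volume :=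
    (Measure.measurePreserving_neg (volume : Measure ℝ)).quasiMeasurePreserving
  set d : Lp ℂ 2 (volume : Measure ℝ) := Lp.compMeasurePreserving (fun x : ℝ ↦ -x)
    (Measure.measurePreserving_neg (volume : Measure ℝ)) (𝓕 b : Lp ℂ 2 (volume : Measure ℝ)) with hd
  have hd_eq : d = (𝓕⁻ b : Lp ℂ 2 (volume : Measure ℝ)) := (fourierInv_eq_compNeg_fourier b).symm
  have hdc := coeFn_compNeg (F := ℂ) (𝓕 b : Lp ℂ 2 (volume : Measure ℝ))
  have hd0 : ∀ᵐ x : ℝ, x ∉ Ioo (-r) r → d x = 0 := by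
    have hb' := hneg.ae hb
    filter_upwards [hdc, hb'] with x hx h hxs
    rw [hx]
    exact h fun hm ↦ hxs ⟨by linarith [hm.2], by linarith [hm.1]⟩
  obtain ⟨hdi, hdle⟩ :=
    integral_norm_le_of_supported measurableSet_Ioo measure_Ioo_lt_top.ne d hd0
  have hd2 : MemLp (fun x ↦ (d : ℝ → ℂ) x) 2 volume := Lp.memLp d
  have hbF : b = (𝓕 (hd2.toLp fun x ↦ (d : ℝ → ℂ) x) : Lp ℂ 2 (volume : Measure ℝ)) := by
    rw [Lp.toLp_coeFn d hd2, hd_eq, fourier_fourierInv_eq]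
  have hae := fourier_toLp_ae_eq_fourierIntegral hdi hd2
  rw [← hbF] at hae
  have hnorm : ‖d‖ = ‖b‖ := by
    rw [hd, Lp.norm_compMeasurePreserving, Lp.norm_fourier_eq]
  filter_upwards [hae] with x hx
  rw [hx]
  calc ‖𝓕 (fun x ↦ (d : ℝ → ℂ) x) x‖ ≤ ∫ y, ‖(d : ℝ → ℂ) y‖ :=
        VectorFourier.norm_fourierIntegral_le_integral_norm _ _ _ _ _
    _ ≤ Real.sqrt (volume.real (Ioo (-r) r)) * ‖d‖ := hdle
    _ = Real.sqrt (volume.real (Ioo (-r) r)) * ‖b‖ := by rw [hnorm]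

/-- **Quasi-orthogonality of `A` and `B`.** For `a` vanishing a.e. off `(−r,r)` and `b` with `𝓕b`
vanishing a.e. off `(−r,r)`: `|⟨a, b⟩| ≤ |(−r,r)|·‖a‖‖b‖` (the Hilbert–Schmidt bound for `P_r𝓕P_r`).
[cite: Burnol2004, §6 (TeX l.2283–2290)] -/
private theorem norm_inner_le_of_supported {r : ℝ} (a b : Lp ℂ 2 (volume : Measure ℝ))
    (ha : ∀ᵐ x : ℝ, x ∉ Ioo (-r) r → a x = 0)
    (hb : ∀ᵐ x : ℝ, x ∉ Ioo (-r) r → ((𝓕 b : Lp ℂ 2 (volume : Measure ℝ)) : ℝ → ℂ) x = 0) :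
    ‖⟪a, b⟫_ℂ‖ ≤ volume.real (Ioo (-r) r) * ‖a‖ * ‖b‖ := by
  obtain ⟨hai, hale⟩ :=
    integral_norm_le_of_supported measurableSet_Ioo measure_Ioo_lt_top.ne a ha
  have hsup := ae_norm_le_of_fourier_supported b hb
  set m : ℝ := volume.real (Ioo (-r) r) with hm
  have hm0 : 0 ≤ m := measureReal_nonneg
  rw [L2.inner_def]
  have hprod : Integrable (fun x ↦ ‖a x‖ * ‖b x‖) :=
    (Lp.memLp a).norm.integrable_mul (Lp.memLp b).norm
  calc ‖∫ x, ⟪a x, b x⟫_ℂ‖ ≤ ∫ x, ‖⟪a x, b x⟫_ℂ‖ := norm_integral_le_integral_norm _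
    _ = ∫ x, ‖a x‖ * ‖b x‖ := by
        refine integral_congr_ae (Eventually.of_forall fun x ↦ ?_)
        simp only [RCLike.inner_apply, norm_mul, RCLike.norm_conj, mul_comm]
    _ ≤ ∫ x, ‖a x‖ * (Real.sqrt m * ‖b‖) := by
        refine integral_mono_ae hprod (hai.norm.mul_const _) ?_
        filter_upwards [hsup] with x hx
        exact mul_le_mul_of_nonneg_left hx (norm_nonneg _)
    _ = (∫ x, ‖a x‖) * (Real.sqrt m * ‖b‖) := integral_mul_const _ _
    _ ≤ Real.sqrt m * ‖a‖ * (Real.sqrt m * ‖b‖) := by gcongr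
    _ = m * ‖a‖ * ‖b‖ := by
        have : Real.sqrt m * Real.sqrt m = m := Real.mul_self_sqrt hm0
        calc Real.sqrt m * ‖a‖ * (Real.sqrt m * ‖b‖)
            = Real.sqrt m * Real.sqrt m * ‖a‖ * ‖b‖ := by ring
          _ = m * ‖a‖ * ‖b‖ := by rw [this]

/-- Elementary Hilbert-space inequality: if `|⟨a,b⟩| ≤ c‖a‖‖b‖` with `0 ≤ c` then
`(1 − c)(‖a‖² + ‖b‖²) ≤ ‖a + b‖²`. [folklore] -/
private theorem sq_add_sq_le_of_inner_le {E : Type*} [NormedAddCommGroup E] [InnerProductSpace ℂ E]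
    (a b : E) {c : ℝ} (hc0 : 0 ≤ c) (h : ‖⟪a, b⟫_ℂ‖ ≤ c * ‖a‖ * ‖b‖) :
    (1 - c) * (‖a‖ ^ 2 + ‖b‖ ^ 2) ≤ ‖a + b‖ ^ 2 := by
  rw [norm_add_sq (𝕜 := ℂ) a b]
  have hre : -(c * ‖a‖ * ‖b‖) ≤ RCLike.re ⟪a, b⟫_ℂ := by
    have h1 : |RCLike.re ⟪a, b⟫_ℂ| ≤ ‖⟪a, b⟫_ℂ‖ := RCLike.abs_re_le_norm ⟪a, b⟫_ℂ
    have h2 : -|RCLike.re ⟪a, b⟫_ℂ| ≤ RCLike.re ⟪a, b⟫_ℂ := neg_abs_le (RCLike.re ⟪a, b⟫_ℂ)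
    linarith
  have h3 : 2 * (c * ‖a‖ * ‖b‖) ≤ c * (‖a‖ ^ 2 + ‖b‖ ^ 2) := by
    have h4 : 2 * ‖a‖ * ‖b‖ ≤ ‖a‖ ^ 2 + ‖b‖ ^ 2 := two_mul_le_add_sq ‖a‖ ‖b‖
    have h5 := mul_le_mul_of_nonneg_left h4 hc0
    linarith
  linarith

/-- `|⟨a, ψ⟩| ≤ ‖a‖·‖𝟙_s ψ‖₂` for `a` vanishing a.e. off `s`. [folklore] -/
private theorem norm_inner_le_norm_mul_norm_cut {s : Set ℝ} (hs : MeasurableSet s)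
    (a ψ : Lp ℂ 2 (volume : Measure ℝ)) (ha : ∀ᵐ x : ℝ, x ∉ s → a x = 0) :
    ‖⟪a, ψ⟫_ℂ‖ ≤ ‖a‖ * ‖((Lp.memLp ψ).indicator hs).toLp (s.indicator ⇑ψ)‖ := by
  set c : Lp ℂ 2 (volume : Measure ℝ) := ((Lp.memLp ψ).indicator hs).toLp (s.indicator ⇑ψ) with hc
  have hcut : (c : ℝ → ℂ) =ᵐ[volume] s.indicator ⇑ψ := MemLp.coeFn_toLp _
  have heq : ⟪a, ψ⟫_ℂ = ⟪a, c⟫_ℂ := by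
    rw [L2.inner_def, L2.inner_def]
    refine integral_congr_ae ?_
    filter_upwards [ha, hcut] with x hax hx
    rw [hx]
    by_cases hxs : x ∈ s
    · rw [Set.indicator_of_mem hxs]
    · rw [Set.indicator_of_notMem hxs, hax hxs]
      simp
  rw [heq]
  exact norm_inner_le_norm (𝕜 := ℂ) a c

/-! ### Step 3: an even vector orthogonal to every `K_r` vanishes -/

/-- **Key lemma.** An even `t ∈ L²(ℝ)` orthogonal to `K_r` for every `r > 0` is `0`.
[cite: Burnol2004, Prop. 6.6 (TeX l.2351–2368) and §6 (TeX l.2258–2259, 2283–2290)] -/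
private theorem eq_zero_of_orthogonal_sonineK {t : Lp ℂ 2 (volume : Measure ℝ)} (ht : t ∈ evenL2)
    (hK : ∀ r : ℝ, 0 < r → ∀ k ∈ sonineK r, ⟪k, t⟫_ℂ = 0) : t = 0 := by
  -- Step 3a: the estimate `‖t‖² ≤ 2‖t‖(ρ₁ + ρ₂)` for every `0 < r ≤ 1/4`
  have step : ∀ r : ℝ, 0 < r → r ≤ 1 / 4 →
      ‖t‖ ^ 2 ≤ 2 * ‖t‖ *
        (‖((Lp.memLp t).indicator (measurableSet_Ioo (a := -r) (b := r))).toLp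
            ((Ioo (-r) r).indicator ⇑t)‖ +
          ‖((Lp.memLp (𝓕 t : Lp ℂ 2 (volume : Measure ℝ))).indicator
              (measurableSet_Ioo (a := -r) (b := r))).toLp
            ((Ioo (-r) r).indicator ⇑(𝓕 t : Lp ℂ 2 (volume : Measure ℝ)))‖) := by
    intro r hr hr4
    set ρ₁ := ‖((Lp.memLp t).indicator (measurableSet_Ioo (a := -r) (b := r))).toLp
        ((Ioo (-r) r).indicator ⇑t)‖ with hρ₁
    set ρ₂ := ‖((Lp.memLp (𝓕 t : Lp ℂ 2 (volume : Measure ℝ))).indicator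
          (measurableSet_Ioo (a := -r) (b := r))).toLp
        ((Ioo (-r) r).indicator ⇑(𝓕 t : Lp ℂ 2 (volume : Measure ℝ)))‖ with hρ₂
    have hρ₁0 : 0 ≤ ρ₁ := norm_nonneg _
    have hρ₂0 : 0 ≤ ρ₂ := norm_nonneg _
    have hms : volume.real (Ioo (-r) r) = 2 * r := by
      rw [Real.volume_real_Ioo_of_le (by linarith)]; ring
    -- the two subspaces
    let A : Submodule ℂ (Lp ℂ 2 (volume : Measure ℝ)) :=
      { carrier := {a | ∀ᵐ x : ℝ, x ∉ Ioo (-r) r → a x = 0}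
        add_mem' := by
          intro a b ha hb
          simp only [Set.mem_setOf_eq] at ha hb ⊢
          filter_upwards [Lp.coeFn_add a b, ha, hb] with x hx h1 h2 hxs
          rw [hx, Pi.add_apply, h1 hxs, h2 hxs, add_zero]
        zero_mem' := by
          simp only [Set.mem_setOf_eq]
          filter_upwards [Lp.coeFn_zero ℂ 2 (volume : Measure ℝ)] with x hx _
          rw [hx, Pi.zero_apply]
        smul_mem' := by
          intro c a ha
          simp only [Set.mem_setOf_eq] at ha ⊢
          filter_upwards [Lp.coeFn_smul c a, ha] with x hx h1 hxs
          rw [hx, Pi.smul_apply, h1 hxs, smul_zero] }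
    let B : Submodule ℂ (Lp ℂ 2 (volume : Measure ℝ)) :=
      { carrier := {b | ∀ᵐ x : ℝ, x ∉ Ioo (-r) r →
          ((𝓕 b : Lp ℂ 2 (volume : Measure ℝ)) : ℝ → ℂ) x = 0}
        add_mem' := by
          intro a b ha hb
          simp only [Set.mem_setOf_eq] at ha hb ⊢
          rw [FourierAdd.fourier_add]
          filter_upwards [Lp.coeFn_add (𝓕 a : Lp ℂ 2 (volume : Measure ℝ))
            (𝓕 b : Lp ℂ 2 (volume : Measure ℝ)), ha, hb] with x hx h1 h2 hxs
          rw [hx, Pi.add_apply, h1 hxs, h2 hxs, add_zero]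
        zero_mem' := by
          simp only [Set.mem_setOf_eq]
          rw [FourierTransform.fourier_zero (E := Lp ℂ 2 (volume : Measure ℝ))]
          filter_upwards [Lp.coeFn_zero ℂ 2 (volume : Measure ℝ)] with x hx _
          rw [hx, Pi.zero_apply]
        smul_mem' := by
          intro c a ha
          simp only [Set.mem_setOf_eq] at ha ⊢
          rw [FourierSMul.fourier_smul]
          filter_upwards [Lp.coeFn_smul c (𝓕 a : Lp ℂ 2 (volume : Measure ℝ)), ha]
            with x hx h1 hxs
          rw [hx, Pi.smul_apply, h1 hxs, smul_zero] }
    have hmemA : ∀ a : Lp ℂ 2 (volume : Measure ℝ), a ∈ A ↔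
        ∀ᵐ x : ℝ, x ∉ Ioo (-r) r → a x = 0 := fun a ↦ Iff.rfl
    have hmemB : ∀ b : Lp ℂ 2 (volume : Measure ℝ), b ∈ B ↔
        ∀ᵐ x : ℝ, x ∉ Ioo (-r) r → ((𝓕 b : Lp ℂ 2 (volume : Measure ℝ)) : ℝ → ℂ) x = 0 :=
      fun b ↦ Iff.rfl
    -- `t ∈ (A ⊔ B)ᗮᗮ = closure (A ⊔ B)`
    have hperp : t ∈ (A ⊔ B)ᗮᗮ := by
      rw [Submodule.mem_orthogonal]
      intro v hv
      rw [← Submodule.inf_orthogonal, Submodule.mem_inf] at hv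
      obtain ⟨hvA, hvB⟩ := hv
      rw [Submodule.mem_orthogonal] at hvA hvB
      have hv1 : ∀ᵐ x : ℝ, x ∈ Ioo (-r) r → v x = 0 :=
        ae_eq_zero_of_orthogonal_supported measurableSet_Ioo v fun a ha ↦ hvA a ((hmemA a).2 ha)
      have hv2 : ∀ᵐ x : ℝ, x ∈ Ioo (-r) r → ((𝓕 v : Lp ℂ 2 (volume : Measure ℝ)) : ℝ → ℂ) x = 0 :=
        ae_eq_zero_of_orthogonal_supported measurableSet_Ioo _
          (fourier_orthogonal_supported v fun b hb ↦ hvB b ((hmemB b).2 hb))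
      exact inner_eq_zero_of_vanishing ht (hK r hr) v hv1 hv2
    rw [Submodule.orthogonal_orthogonal_eq_closure] at hperp
    have hcl : t ∈ closure ((A ⊔ B : Submodule ℂ (Lp ℂ 2 (volume : Measure ℝ))) :
        Set (Lp ℂ 2 (volume : Measure ℝ))) := by
      rw [← Submodule.topologicalClosure_coe]
      exact hperp
    -- the estimate, for every `ε > 0`
    have hest : ∀ ε : ℝ, 0 < ε → ‖t‖ ^ 2 ≤ ε * ‖t‖ + 2 * (‖t‖ + ε) * (ρ₁ + ρ₂) := by
      intro ε hε
      obtain ⟨w, hw, hdist⟩ := Metric.mem_closure_iff.1 hcl ε hε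
      obtain ⟨a, haA, b, hbB, hab⟩ := Submodule.mem_sup.1 hw
      have haA' := (hmemA a).1 haA
      have hbB' := (hmemB b).1 hbB
      -- norms of the components
      have hab_le : ‖⟪a, b⟫_ℂ‖ ≤ (1 / 2) * ‖a‖ * ‖b‖ := by
        calc ‖⟪a, b⟫_ℂ‖ ≤ volume.real (Ioo (-r) r) * ‖a‖ * ‖b‖ :=
              norm_inner_le_of_supported a b haA' hbB'
          _ ≤ (1 / 2) * ‖a‖ * ‖b‖ := by
              rw [hms]
              gcongr
              linarith
      have hsq := sq_add_sq_le_of_inner_le a b (by norm_num) hab_le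
      rw [hab] at hsq
      have hw_le : ‖w‖ ≤ ‖t‖ + ε := by
        have : ‖w - t‖ < ε := by rwa [← dist_eq_norm, dist_comm]
        calc ‖w‖ = ‖t + (w - t)‖ := by congr 1; abel
          _ ≤ ‖t‖ + ‖w - t‖ := norm_add_le _ _
          _ ≤ ‖t‖ + ε := by linarith
      have ha_le : ‖a‖ ≤ 2 * (‖t‖ + ε) := by
        nlinarith [norm_nonneg a, norm_nonneg b, norm_nonneg w, norm_nonneg t, hsq, hw_le]
      have hb_le : ‖b‖ ≤ 2 * (‖t‖ + ε) := by
        nlinarith [norm_nonneg a, norm_nonneg b, norm_nonneg w, norm_nonneg t, hsq, hw_le]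
      -- `⟨t,t⟩ = ⟨t − w, t⟩ + ⟨a, t⟩ + ⟨b, t⟩`
      have hsplit : ⟪t, t⟫_ℂ = ⟪t - w, t⟫_ℂ + ⟪a, t⟫_ℂ + ⟪b, t⟫_ℂ := by
        rw [← inner_add_left, ← inner_add_left]
        congr 1
        rw [← hab]; abel
      have h_tw : ‖⟪t - w, t⟫_ℂ‖ ≤ ε * ‖t‖ := by
        calc ‖⟪t - w, t⟫_ℂ‖ ≤ ‖t - w‖ * ‖t‖ := norm_inner_le_norm _ _
          _ ≤ ε * ‖t‖ := by
              gcongr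
              rw [← dist_eq_norm]; exact hdist.le
      have h_a : ‖⟪a, t⟫_ℂ‖ ≤ ‖a‖ * ρ₁ :=
        norm_inner_le_norm_mul_norm_cut measurableSet_Ioo a t haA'
      have h_b : ‖⟪b, t⟫_ℂ‖ ≤ ‖b‖ * ρ₂ := by
        rw [← Lp.inner_fourier_eq b t]
        calc ‖⟪(𝓕 b : Lp ℂ 2 (volume : Measure ℝ)), (𝓕 t : Lp ℂ 2 (volume : Measure ℝ))⟫_ℂ‖
            ≤ ‖(𝓕 b : Lp ℂ 2 (volume : Measure ℝ))‖ * ρ₂ :=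
              norm_inner_le_norm_mul_norm_cut measurableSet_Ioo _ _ hbB'
          _ = ‖b‖ * ρ₂ := by rw [Lp.norm_fourier_eq]
      have hnorm_sq : ‖t‖ ^ 2 = ‖⟪t, t⟫_ℂ‖ := by
        rw [inner_self_eq_norm_sq_to_K]
        norm_cast
        rw [abs_of_nonneg (by positivity)]
      calc ‖t‖ ^ 2 = ‖⟪t, t⟫_ℂ‖ := hnorm_sq
        _ = ‖⟪t - w, t⟫_ℂ + ⟪a, t⟫_ℂ + ⟪b, t⟫_ℂ‖ := by rw [hsplit]
        _ ≤ ‖⟪t - w, t⟫_ℂ‖ + ‖⟪a, t⟫_ℂ‖ + ‖⟪b, t⟫_ℂ‖ := norm_add₃_le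
        _ ≤ ε * ‖t‖ + ‖a‖ * ρ₁ + ‖b‖ * ρ₂ := by gcongr
        _ ≤ ε * ‖t‖ + 2 * (‖t‖ + ε) * ρ₁ + 2 * (‖t‖ + ε) * ρ₂ := by gcongr
        _ = ε * ‖t‖ + 2 * (‖t‖ + ε) * (ρ₁ + ρ₂) := by ring
    -- `ε → 0`
    refine le_of_forall_pos_le_add fun η hη ↦ ?_
    set ε : ℝ := η / (‖t‖ + 2 * (ρ₁ + ρ₂) + 1) with hε_def
    have hden : 0 < ‖t‖ + 2 * (ρ₁ + ρ₂) + 1 := by positivity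
    have hε : 0 < ε := div_pos hη hden
    have hεη : ε * (‖t‖ + 2 * (ρ₁ + ρ₂)) ≤ η := by
      rw [hε_def, div_mul_eq_mul_div, div_le_iff₀ hden]
      nlinarith
    calc ‖t‖ ^ 2 ≤ ε * ‖t‖ + 2 * (‖t‖ + ε) * (ρ₁ + ρ₂) := hest ε hε
      _ = 2 * ‖t‖ * (ρ₁ + ρ₂) + ε * (‖t‖ + 2 * (ρ₁ + ρ₂)) := by ring
      _ ≤ 2 * ‖t‖ * (ρ₁ + ρ₂) + η := by linarith
  -- Step 3b: `r → 0`
  by_contra htne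
  have htpos : 0 < ‖t‖ := norm_pos_iff.2 htne
  have hε8 : 0 < ‖t‖ / 8 := by positivity
  obtain ⟨δ₁, hδ₁, h₁⟩ := (Lp.memLp t).eLpNorm_indicator_le (p := 2) one_le_two (by norm_num) hε8
  obtain ⟨δ₂, hδ₂, h₂⟩ :=
    (Lp.memLp (𝓕 t : Lp ℂ 2 (volume : Measure ℝ))).eLpNorm_indicator_le (p := 2) one_le_two
      (by norm_num) hε8
  set r : ℝ := min (1 / 4) (min δ₁ δ₂ / 2) with hr_def
  have hr : 0 < r := lt_min (by norm_num) (by positivity)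
  have hr4 : r ≤ 1 / 4 := min_le_left _ _
  have hvol : volume (Ioo (-r) r) = ENNReal.ofReal (2 * r) := by
    rw [Real.volume_Ioo]; congr 1; ring
  have hrδ₁ : volume (Ioo (-r) r) ≤ ENNReal.ofReal δ₁ := by
    rw [hvol]
    apply ENNReal.ofReal_le_ofReal
    have : r ≤ min δ₁ δ₂ / 2 := min_le_right _ _
    linarith [min_le_left δ₁ δ₂]
  have hrδ₂ : volume (Ioo (-r) r) ≤ ENNReal.ofReal δ₂ := by
    rw [hvol]
    apply ENNReal.ofReal_le_ofReal
    have : r ≤ min δ₁ δ₂ / 2 := min_le_right _ _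
    linarith [min_le_right δ₁ δ₂]
  have hρ₁ : ‖((Lp.memLp t).indicator (measurableSet_Ioo (a := -r) (b := r))).toLp
      ((Ioo (-r) r).indicator ⇑t)‖ ≤ ‖t‖ / 8 := by
    rw [Lp.norm_toLp]
    have := h₁ (Ioo (-r) r) measurableSet_Ioo hrδ₁
    calc (eLpNorm ((Ioo (-r) r).indicator ⇑t) 2 volume).toReal
        ≤ (ENNReal.ofReal (‖t‖ / 8)).toReal := ENNReal.toReal_mono ENNReal.ofReal_ne_top this
      _ = ‖t‖ / 8 := ENNReal.toReal_ofReal hε8.le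
  have hρ₂ : ‖((Lp.memLp (𝓕 t : Lp ℂ 2 (volume : Measure ℝ))).indicator
        (measurableSet_Ioo (a := -r) (b := r))).toLp
      ((Ioo (-r) r).indicator ⇑(𝓕 t : Lp ℂ 2 (volume : Measure ℝ)))‖ ≤ ‖t‖ / 8 := by
    rw [Lp.norm_toLp]
    have := h₂ (Ioo (-r) r) measurableSet_Ioo hrδ₂
    calc (eLpNorm ((Ioo (-r) r).indicator ⇑(𝓕 t : Lp ℂ 2 (volume : Measure ℝ))) 2 volume).toReal
        ≤ (ENNReal.ofReal (‖t‖ / 8)).toReal := ENNReal.toReal_mono ENNReal.ofReal_ne_top this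
      _ = ‖t‖ / 8 := ENNReal.toReal_ofReal hε8.le
  have h := step r hr hr4
  nlinarith

/-! ### Step 4: the discharge -/

/-- **Prop. 6.6 (iii) holds: `closure ⋃_{λ>0} K_λ = K`** — the Sonine functions are dense in the even
square-integrable functions. [cite: Burnol2004, Proposition 6.6 (TeX l.2351–2368)] -/
theorem Burnol2004_prop_6_6_holds : Burnol2004_prop_6_6 := by
  apply Set.Subset.antisymm closure_iUnion_sonineK_subset_evenL2
  intro g hg
  -- the directed union `⋃_{λ>0} K_λ` as a linear subspace
  let S : Submodule ℂ (Lp ℂ 2 (volume : Measure ℝ)) :=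
    { carrier := ⋃ lam ∈ Set.Ioi (0 : ℝ), sonineK lam
      add_mem' := by
        intro a b ha hb
        obtain ⟨r₁, hr₁, ha⟩ := Set.mem_iUnion₂.1 ha
        obtain ⟨r₂, hr₂, hb⟩ := Set.mem_iUnion₂.1 hb
        exact Set.mem_iUnion₂.2 ⟨min r₁ r₂, Set.mem_Ioi.2 (lt_min (Set.mem_Ioi.1 hr₁) (Set.mem_Ioi.1 hr₂)),
          add_mem_sonineK (sonineK_antitone (min_le_left r₁ r₂) ha)
            (sonineK_antitone (min_le_right r₁ r₂) hb)⟩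
      zero_mem' := Set.mem_iUnion₂.2 ⟨1, Set.mem_Ioi.2 one_pos, zero_mem_sonineK 1⟩
      smul_mem' := by
        intro c a ha
        obtain ⟨r, hr, ha⟩ := Set.mem_iUnion₂.1 ha
        exact Set.mem_iUnion₂.2 ⟨r, hr, smul_mem_sonineK c ha⟩ }
  have hScoe : (S : Set (Lp ℂ 2 (volume : Measure ℝ))) = ⋃ lam ∈ Set.Ioi (0 : ℝ), sonineK lam := rfl
  let M : Submodule ℂ (Lp ℂ 2 (volume : Measure ℝ)) := S.topologicalClosure
  have hMcl : (M : Set (Lp ℂ 2 (volume : Measure ℝ))) =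
      closure (⋃ lam ∈ Set.Ioi (0 : ℝ), sonineK lam) := by
    rw [← hScoe]
    exact Submodule.topologicalClosure_coe S
  have htM : g - M.starProjection g ∈ Mᗮ := Submodule.sub_starProjection_mem_orthogonal g
  have hpM : M.starProjection g ∈ M := Submodule.starProjection_apply_mem M g
  have hp_even : M.starProjection g ∈ evenL2 := by
    apply closure_iUnion_sonineK_subset_evenL2
    rw [← hMcl]
    exact hpM
  have ht_even : g - M.starProjection g ∈ evenL2 := by
    rw [sub_eq_add_neg, ← neg_one_smul ℂ (M.starProjection g)]
    exact add_mem_evenL2 hg (smul_mem_evenL2 _ hp_even)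
  have hK : ∀ r : ℝ, 0 < r → ∀ k ∈ sonineK r, ⟪k, g - M.starProjection g⟫_ℂ = 0 := by
    intro r hr k hk
    have hkS : k ∈ S := Set.mem_iUnion₂.2 ⟨r, Set.mem_Ioi.2 hr, hk⟩
    exact (Submodule.mem_orthogonal M _).1 htM k (S.le_topologicalClosure hkS)
  have ht0 : g - M.starProjection g = 0 := eq_zero_of_orthogonal_sonineK ht_even hK
  have hg' : g = M.starProjection g := sub_eq_zero.1 ht0
  change g ∈ closure (⋃ lam ∈ Set.Ioi (0 : ℝ), sonineK lam)
  rw [← hMcl, hg']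
  exact hpM

end SonineDensity

end Literature.NumberTheory.LFunctions
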